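import Literature.AlgebraicGeometry.HodgeTheory.VHSDataChartTateTwistConstant
import Literature.AlgebraicGeometry.HodgeTheory.PolarizedLimitMixedHodgeStructureCoordinateChange
import Literature.AlgebraicGeometry.Motives.FamiliesVHSDual
import Mathlib.LinearAlgebra.BilinearForm.DualLattice
import HarnessLib

/-!
# Local period charts of the DUAL variation `D^∨` (puncture and interior) from the charts of `D`; CDK Theorem 1.1 for `D^∨`

Topic `Literature/AlgebraicGeometry/HodgeTheory` (namespaces `Literature.AlgebraicGeometry.Motives[.HodgeStructure.Polarization ∕ .VHSData(.PunctureChart ∕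
.InteriorChart)]`, `….HodgeTheory.PolarizedLimitMixedHodgeStructure`), lane `lit-hodgefound` (seat `p08`, row g58-#5); sequel of `VHSDataPunctureChart`
(`PunctureChart`, `⊗`), `VHSDataInteriorChart` (`InteriorChart`, `⊗`, Thm 1.1 from bundled charts) and `VHSDataChartTateTwistConstant` (Tate twists,
`cast`).  DEFINITIONS WITH BODIES (`VHSData.ofDualFiber`, `VHSData.dualTriv`, `Motives.liftIntDual`, **`PunctureChart.dual`**, **`InteriorChart.dual`**)
and THEOREMS; no named fact, no instance, no notation (D-0026 net debt `0`).

PRINTED SOURCES.  E. Cattani, P. Deligne, A. Kaplan, *On the locus of Hodge classes*, J. AMS 8 (1995): §1 (pp. 483–484: the setting, «polarized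
variation of Hodge structure», the Hodge loci `S^{(K)}` of integral classes), (2.4) (p. 488: «on `ℋ^r`, the pullback of the local system `𝒱_ℤ` can be
trivialized»), 2.7 (2.7.1) (p. 489: `Φ(z) = exp(zN)·exp Γ(s)·F`), Thm. 1.1 ∕ Cor. 1.2 (p. 484) and «1.5 ⟹ 1.1» (p. 485).  P. Deligne, *Hodge cycles on
abelian varieties*, LNM 900, I, proof of Prop. 3.6: a polarization `ψ` of a Hodge structure `V` of weight `n` is a morphism `V ⊗ V → ℚ(−n)`,
i.e. an isomorphism **`V ⥲ V^∨(−n)`** — in the tree `Polarization.toDualEquiv = θ = Q♭`, `Polarization.dualToTwistHom` (`θ⁻¹ : H^∨ → H(n)`),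
`Polarization.dual` (the inverse form `Q^∨(φ, ψ) = Q(θ⁻¹φ, θ⁻¹ψ)`, B. Moonen, *Families of motives and the Mumford–Tate conjecture* (2017) §2.1), and
for polarized limit mixed Hodge structures `comapEquiv_qFlatEquiv_symm : L.comapEquiv Q♭⁻¹ = L^∨(−k)`.  W. Schmid, *Variation of Hodge structure*
(1973), §2: variations are stable under duals (cite only).  N. Bourbaki, *Algebra I*, Ch. II §5 no. 4 (dual bases, dual lattices).

THE POINT.  Through the fibrewise polarization isomorphisms `θ_s⁻¹ : V_s^∨ ⥲ V_s` (which are RATIONAL, not integral: `Q_s` need not be unimodular)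
a chart of `D` IS a chart of `D^∨`, with the same reference space `V`, the reference structures twisted by `k` (`L(k)`, `(H₀(k), Q₀)`, re-indexed to
weight `−k` by `cast`), the same gauge ∕ frame ∕ height ∕ comparison constant, the trivializations `e^∨ = e ∘ θ_s⁻¹`, and ONE new integral datum: the
lattice becomes the **`Q`-dual lattice `Λ^# = {x ∈ V | Q(x, Λ) ⊆ ℤ}`** (Mathlib's `LinearMap.BilinForm.dualSubmodule`) `= e^∨(V_ℤ,s^∨)`.

CONTENT.
* §0 polarized duals in the Hodge metric: `hodgeNorm_comap` (`‖x‖_{f^*Q} = ‖f_ℂ x‖_Q` for an injective morphism), `hodgeNorm_cast`,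
  `hodgeNorm_tateTwist_cast`, **`map_dual_F_toDualEquiv_symm`** (`θ⁻¹_ℂ F^q(H^∨) = F^{q+n}(H)`), **`hodgeNorm_dual`** (`‖ξ‖_{Q^∨} = ‖θ⁻¹_ℂ ξ‖_Q`),
  `dual_form_baseChange`.
* §1 the reference `(L(j)).cast h` (`tateTwist_cast_F ∕ _N ∕ _Q ∕ _monodromy ∕ _endPiece_biSup`); **`exists_mem_monodromy_eq`** (the unipotent `T = e^N`
  maps a `T`-stable lattice ONTO itself: `T = 1 − U`, `U` nilpotent, `T ∑_{i<m} U^i y = y`), **`monodromy_mem_dualSubmodule`** (`T(Λ^#) ⊆ Λ^#`),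
  **`fg_dualSubmodule`** (the dual of a full finitely generated lattice is finitely generated: it embeds in `Hom_ℤ(Λ, ℤ)`, Mathlib
  `dualSubmoduleToDual_injective`), `mem_dualSubmodule_iff_exists_intCast`.
* §2 the fibre of `D^∨`: `span_range_toRat_eq_top` (`V_s = ℚ·toRat(V_ℤ,s)`), `ofDualFiber` (`θ_s⁻¹`), `form_ofDualFiber_apply`, `dual_form_eq`,
  **`map_dual_hodge_F`** (`θ_s⁻¹ F^q(V_s^∨) = F^{q+k}(V_s)`), **`dual_hodgeNorm_eq`**, `form_ofDualFiber_dual_toRat` (`Q_s(θ⁻¹ toRat^∨φ, toRat u) = φ(u)`),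
  `liftIntDual` (an integer-valued `ℤ`-linear map into `ℚ` as an integral functional, for the `ModuleCat ℤ` instance of the fibres), `dualTriv`
  (`e^∨ = e ∘ θ_s⁻¹`) with `map_dual_hodge_F_dualTriv`, `dual_form_eq_chart`, **`dualTriv_toRat_mem`** (`e^∨(V_ℤ^∨) ⊆ Λ^#`) and
  **`exists_dualTriv_toRat_eq`** (`Λ^# ⊆ e^∨(V_ℤ^∨)`, by nondegeneracy and `V_s = ℚ·V_ℤ,s`).
* §3 **`PunctureChart.dual : D.PunctureChart σ L → D^∨.PunctureChart σ ((L(k)).cast _)`** (`span_Λ_eq_top`; rfl API `dual_Γ ∕ dual_Λ ∕ dual_e ∕ dual_A₀`).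
* §4 **`InteriorChart.dual : D.InteriorChart ψ Q₀ → D^∨.InteriorChart ψ ((Q₀(k)).cast _)`** (`dual_h ∕ dual_κ ∕ dual_e ∕ dual_Λ`; the lattice is `Λ^#` on a
  disc with a point and `⊥` on the empty disc, where the chart claims nothing).
* §5 **CDK THEOREM 1.1 ∕ COROLLARY 1.2 (`r = 1`) FOR `D^∨` FROM THE CHARTS OF `D`** over a curve and over a punctured compact curve
  (`hodgeLocusOfNormLe_dual_eq_univ_or_finite(_of_compactification)`).

With `PunctureChart.tensor ∕ InteriorChart.tensor`, `cast`, `unit` and this file, every mixed tensor space `T^{a,b}D = D^{⊗a} ⊗ (D^∨)^{⊗b}`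
(`VHSData.tensorSpace`) is charted from charts of `D` (assembled in the sequel).

## References

* [CattaniDeligneKaplan1995] E. Cattani, P. Deligne, A. Kaplan, *On the locus of Hodge classes*, J. Amer. Math. Soc. 8 (1995), §1 (pp. 483–484),
  Thm. 1.1, Cor. 1.2, (2.4) (p. 488), 2.7 (p. 489), p. 485.
* [Deligne1982HodgeCycles] P. Deligne, *Hodge cycles on abelian varieties*, LNM 900 (1982), I, proof of Prop. 3.6.
* [DeligneHodgeII1971] P. Deligne, *Théorie de Hodge II*, Publ. Math. IHÉS 40 (1971), 1.1.6–1.1.7, 2.1.14–2.1.15.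
* [Moonen2017FamiliesMotives] B. Moonen, *Families of motives and the Mumford–Tate conjecture*, Milan J. Math. 85 (2017), §2.1 (p. 3).
* [CattaniElZeinGriffithsLe2014] E. Cattani et al. (eds.), *Hodge Theory* (2014), Ex. 3.2.23 (4), Def. 7.5.9, §7.5 (7.5.2), (7.6.2).
* [CarlsonMullerStachPeters2017] J. Carlson, S. Müller-Stach, C. Peters, *Period Mappings and Period Domains*, 2nd ed. (2017), §2.3 (2.6), Thm. 2.3.3.
* [Morrison1984ClemensSchmid] D. Morrison, *The Clemens–Schmid exact sequence and applications* (1984), §2 (`T` unipotent, `N = log T`).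
* [Deligne1980] P. Deligne, *La conjecture de Weil II*, Publ. Math. IHÉS 52 (1980), (1.6.9) (ii) (the dual of `(V, N)`).
* [BourbakiAlgebraI1989] N. Bourbaki, *Algebra I*, Ch. II §5 no. 4.
* [Schmid1973] W. Schmid, *Variation of Hodge structure*, Invent. Math. 22 (1973), §2 (cite only).
* [Deligne1970] P. Deligne, *Équations différentielles à points singuliers réguliers*, LNM 163 (1970), I.1 (local systems).
-/

noncomputable section

open scoped TensorProduct ComplexOrder
open _root_.Topology _root_.Filter Set

namespace Literature.AlgebraicGeometry

open Module
open Motives Motives.MixedHodgeStructure Motives.HodgeStructure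
open Motives.HodgeStructure (conj conj_baseChange)
open HodgeTheory

universe u v

/-! ## §0 The polarization isomorphism `θ = Q♭ : H(n) ⥲ H^∨` in the Hodge metric and on the filtrations -/

namespace Motives.HodgeStructure.Polarization

variable {V : Type u} [AddCommGroup V] [Module ℚ V] {W : Type v} [AddCommGroup W] [Module ℚ W] {n m : ℤ}

/-- **The Hodge norm of a pulled-back polarization**: `‖x‖_{f^*Q} = ‖f_ℂ x‖_Q` for an injective morphism of Hodge structures `f : H₁ → H₂`
(`f_ℂ` commutes with the Weil operators and with complex conjugation). [cite: CarlsonMullerStachPeters2017, §2.3 eq. (2.6) and Thm. 2.3.3] -/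
theorem hodgeNorm_comap {H₁ : HodgeStructure V n} {H₂ : HodgeStructure W n} (Q : Polarization H₂) (f : Hom H₁ H₂)
    (hf : Function.Injective f.toLinearMap) (x : ℂ ⊗[ℚ] V) :
    (Q.comap f hf).hodgeNorm x = Q.hodgeNorm (f.toLinearMap.baseChange ℂ x) := by
  unfold hodgeNorm
  rw [show (Q.comap f hf).form = Q.form.compl₁₂ f.toLinearMap f.toLinearMap from rfl, baseChange_compl₁₂, f.baseChange_weilOperator,
    ← conj_baseChange]

/-- `‖x‖_{Q.cast h} = ‖x‖_Q`. [cite: CarlsonMullerStachPeters2017, §2.3 Thm. 2.3.3] -/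
theorem hodgeNorm_cast {H : HodgeStructure V n} (Q : Polarization H) (h : n = m) (x : ℂ ⊗[ℚ] V) :
    (Q.cast h).hodgeNorm x = Q.hodgeNorm x := by
  subst h
  rfl

/-- `‖x‖` for the reference `(Q(j)).cast h` is `‖x‖_Q`. [cite: CarlsonMullerStachPeters2017, §2.3 Thm. 2.3.3] [cite: DeligneHodgeII1971, 2.1.14] -/
theorem hodgeNorm_tateTwist_cast {H : HodgeStructure V n} (Q : Polarization H) (j : ℤ) (h : n - 2 * j = m) (x : ℂ ⊗[ℚ] V) :
    ((Q.tateTwist j).cast h).hodgeNorm x = Q.hodgeNorm x := by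
  subst h
  exact Q.hodgeNorm_tateTwist j x

/-- The form of `(Q(j)).cast h` is that of `Q`. [cite: DeligneHodgeII1971, 2.1.14–2.1.15] -/
theorem tateTwist_cast_form {H : HodgeStructure V n} (Q : Polarization H) (j : ℤ) (h : n - 2 * j = m) :
    ((Q.tateTwist j).cast h).form = Q.form := by
  subst h
  rfl

omit [Module ℚ V] in
/-- The filtration of `(H(j)).cast h` is `F^q = F^{q+j}(H)`. [cite: DeligneHodgeII1971, 2.1.14] -/
theorem _root_.Literature.AlgebraicGeometry.Motives.HodgeStructure.tateTwist_cast_F [Module ℚ V] (H : HodgeStructure V n) (j : ℤ)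
    (h : n - 2 * j = m) (q : ℤ) : ((H.tateTwist j).cast h).F q = H.F (q + j) := by
  subst h
  exact H.tateTwist_F j q

variable [Module.Finite ℚ V] [HodgeTensorFacts.{u, u}]

/-- **`θ⁻¹_ℂ F^q(H^∨) = F^{q+n}(H)`** for `θ = Q♭ : V ⥲ V^∨` (`θ⁻¹ : H^∨ → H(n)` and `θ : H(n) → H^∨` are mutually inverse morphisms of Hodge
structures: the tree's `Polarization.map_dualFiltration_le_F`, `Polarization.map_F_le_dualFiltration`).
[cite: Deligne1982HodgeCycles, I Prop. 3.6 (proof)] [cite: DeligneHodgeII1971, 1.1.6–1.1.7 and 2.1.15] -/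
theorem map_dual_F_toDualEquiv_symm {H : HodgeStructure V n} (Q : Polarization H) (q : ℤ) :
    (H.dual.F q).map ((Q.toDualEquiv.symm : Module.Dual ℚ V →ₗ[ℚ] V).baseChange ℂ) = H.F (q + n) := by
  refine le_antisymm (by rw [dual_F]; exact Q.map_dualFiltration_le_F q) ?_
  intro x hx
  refine ⟨(Q.toDualEquiv : V →ₗ[ℚ] Module.Dual ℚ V).baseChange ℂ x, ?_, ?_⟩
  · rw [dual_F]
    have h := Q.map_F_le_dualFiltration (q + n) ⟨x, hx, rfl⟩
    rwa [show q + n - n = q by ring] at h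
  · rw [← LinearMap.comp_apply, ← LinearMap.baseChange_comp,
      show (Q.toDualEquiv.symm : Module.Dual ℚ V →ₗ[ℚ] V) ∘ₗ (Q.toDualEquiv : V →ₗ[ℚ] Module.Dual ℚ V) = LinearMap.id from
        LinearMap.ext fun v => Q.toDualEquiv.symm_apply_apply v,
      LinearMap.baseChange_id, LinearMap.id_apply]

/-- **`‖ξ‖_{Q^∨} = ‖θ⁻¹_ℂ ξ‖_Q`**: the polarization isomorphism `θ⁻¹ : (H^∨, Q^∨) ⥲ (H(n), Q)` is an isometry of Hodge metrics (`Q^∨` is the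
pull-back of `Q` along `θ⁻¹`, and `‖·‖_{H(n)} = ‖·‖_H`). [cite: CarlsonMullerStachPeters2017, §2.3 Thm. 2.3.3] [cite: Moonen2017FamiliesMotives, §2.1 (p. 3)] -/
theorem hodgeNorm_dual {H : HodgeStructure V n} (Q : Polarization H) (ξ : ℂ ⊗[ℚ] Module.Dual ℚ V) :
    Q.dual.hodgeNorm ξ = Q.hodgeNorm ((Q.toDualEquiv.symm : Module.Dual ℚ V →ₗ[ℚ] V).baseChange ℂ ξ) := by
  rw [show Q.dual = ((Q.tateTwist n).cast (tateTwist_self_weight n)).comap Q.dualToTwistHom Q.toDualEquiv.symm.injective from rfl,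
    hodgeNorm_comap, hodgeNorm_tateTwist_cast, dualToTwistHom_toLinearMap]

/-- `Q^∨_ℂ(ξ, η) = Q_ℂ(θ⁻¹_ℂ ξ, θ⁻¹_ℂ η)`. [cite: Moonen2017FamiliesMotives, §2.1 (p. 3)] -/
theorem dual_form_baseChange {H : HodgeStructure V n} (Q : Polarization H) (ξ η : ℂ ⊗[ℚ] Module.Dual ℚ V) :
    Q.dual.form.baseChange ℂ ξ η = Q.form.baseChange ℂ ((Q.toDualEquiv.symm : Module.Dual ℚ V →ₗ[ℚ] V).baseChange ℂ ξ)
      ((Q.toDualEquiv.symm : Module.Dual ℚ V →ₗ[ℚ] V).baseChange ℂ η) := by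
  rw [dual_form, show Q.dualForm = Q.form.compl₁₂ (Q.toDualEquiv.symm : Module.Dual ℚ V →ₗ[ℚ] V) (Q.toDualEquiv.symm : Module.Dual ℚ V →ₗ[ℚ] V)
    from rfl, baseChange_compl₁₂]

end Motives.HodgeStructure.Polarization

/-! ## §1 The reference `L(k)` re-indexed to weight `−k`; the `Q`-dual lattice `Λ^# = {x | Q(x, Λ) ⊆ ℤ}` -/

namespace HodgeTheory.PolarizedLimitMixedHodgeStructure

variable {V : Type u} [AddCommGroup V] [Module ℚ V] [FiniteDimensional ℚ V] {k k' : ℤ} (L : PolarizedLimitMixedHodgeStructure V k)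

/-- `F^q((L(j)).cast h) = F^{q+j}(L)`. [cite: CattaniElZeinGriffithsLe2014, Ex. 3.2.23 (4) and Def. 7.5.9] -/
theorem tateTwist_cast_F (j : ℤ) (h : k - 2 * j = k') (q : ℤ) : ((L.tateTwist j).cast h).F q = L.F (q + j) := by
  subst h
  rfl

/-- `N((L(j)).cast h) = N`. [cite: CattaniElZeinGriffithsLe2014, Def. 7.5.9] -/
theorem tateTwist_cast_N (j : ℤ) (h : k - 2 * j = k') : ((L.tateTwist j).cast h).N = L.N := by
  subst h
  rfl

/-- `Q((L(j)).cast h) = Q`. [cite: CattaniElZeinGriffithsLe2014, Def. 7.5.9] -/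
theorem tateTwist_cast_Q (j : ℤ) (h : k - 2 * j = k') : ((L.tateTwist j).cast h).Q = L.Q := by
  subst h
  rfl

/-- `T((L(j)).cast h) = T`. [cite: CattaniElZeinGriffithsLe2014, Def. 7.5.9] -/
theorem tateTwist_cast_monodromy (j : ℤ) (h : k - 2 * j = k') : ((L.tateTwist j).cast h).monodromy = L.monodromy := by
  subst h
  rfl

/-- `𝔟((L(j)).cast h) = 𝔟(L)` for `𝔟 = ⊕_{a ≤ −1} 𝔤𝔩^{a,b}`. [cite: CattaniDeligneKaplan1995, 2.7 (p. 489)] [cite: CattaniElZeinGriffithsLe2014, (7.6.2)] -/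
theorem tateTwist_cast_endPiece_biSup (j : ℤ) (h : k - 2 * j = k') :
    ⨆ ab ∈ {ab : ℤ × ℤ | ab.1 ≤ -1}, ((L.tateTwist j).cast h).toMixedHodgeStructure.endPiece ab.1 ab.2 =
      ⨆ ab ∈ {ab : ℤ × ℤ | ab.1 ≤ -1}, L.toMixedHodgeStructure.endPiece ab.1 ab.2 := by
  subst h
  exact L.tateTwist_endPiece_biSup j

/-- **Unipotence of the monodromy on the lattice**: if `TΛ ⊆ Λ` then `T` maps `Λ` ONTO `Λ` — `T = 1 − U` with `U = 1 − e^N` nilpotent and `UΛ ⊆ Λ`,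
so `T(∑_{i<m} U^i y) = y − U^m y = y`. [cite: Morrison1984ClemensSchmid, §2] [cite: CattaniDeligneKaplan1995, (2.4) (p. 488)] -/
theorem exists_mem_monodromy_eq {Λ : Submodule ℤ V} (hΛ : ∀ u ∈ Λ, L.monodromy u ∈ Λ) {y : V} (hy : y ∈ Λ) :
    ∃ y' ∈ Λ, L.monodromy y' = y := by
  set U : Module.End ℚ V := 1 - L.monodromy with hU
  have hUnil : IsNilpotent U := by
    have h := (IsNilpotent.isNilpotent_exp_sub_one L.isNilpotent_N).neg
    rwa [neg_sub] at h
  obtain ⟨m, hm⟩ := hUnil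
  have hUmem : ∀ u ∈ Λ, U u ∈ Λ := fun u hu => by
    rw [hU, LinearMap.sub_apply, Module.End.one_apply]
    exact Λ.sub_mem hu (hΛ u hu)
  have hpow : ∀ i : ℕ, ∀ u ∈ Λ, (U ^ i) u ∈ Λ := by
    intro i
    induction i with
    | zero => intro u hu; rwa [pow_zero, Module.End.one_apply]
    | succ i ih => intro u hu; rw [pow_succ, Module.End.mul_apply]; exact ih _ (hUmem u hu)
  refine ⟨(∑ i ∈ Finset.range m, U ^ i) y, ?_, ?_⟩
  · rw [LinearMap.sum_apply]
    exact Λ.sum_mem fun i _ => hpow i y hy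
  · have hT : L.monodromy = 1 - U := by rw [hU, sub_sub_cancel]
    rw [hT, ← Module.End.mul_apply, mul_neg_geom_sum, hm, sub_zero, Module.End.one_apply]

/-- **The `Q`-dual lattice is `T`-stable**: `TΛ ⊆ Λ ⟹ T(Λ^#) ⊆ Λ^#`, `Λ^# = {x | Q(x, Λ) ⊆ ℤ}` (Mathlib's `BilinForm.dualSubmodule`), because
`T` is a `Q`-isometry mapping `Λ` onto `Λ`. [cite: CattaniDeligneKaplan1995, (2.4) (p. 488)] [cite: CattaniElZeinGriffithsLe2014, §7.5 (7.5.2)] -/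
theorem monodromy_mem_dualSubmodule {Λ : Submodule ℤ V} (hΛ : ∀ u ∈ Λ, L.monodromy u ∈ Λ) {x : V} (hx : x ∈ L.Q.dualSubmodule Λ) :
    L.monodromy x ∈ L.Q.dualSubmodule Λ := by
  rw [LinearMap.BilinForm.mem_dualSubmodule] at hx ⊢
  intro y hy
  obtain ⟨y', hy', rfl⟩ := L.exists_mem_monodromy_eq hΛ hy
  rw [L.Q_monodromy]
  exact hx y' hy'

omit [FiniteDimensional ℚ V] in
/-- **The dual of a full lattice is finitely generated**: if `Λ ⊆ V` is finitely generated and spans `V` over `ℚ`, and `B` is nondegenerate, then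
`Λ^# = {x | B(x, Λ) ⊆ ℤ}` is finitely generated (it embeds into `Hom_ℤ(Λ, ℤ)` by Mathlib's `dualSubmoduleToDual_injective`).
[cite: BourbakiAlgebraI1989, Ch. II §5 no. 4] -/
theorem _root_.Literature.AlgebraicGeometry.Motives.fg_dualSubmodule (B : LinearMap.BilinForm ℚ V) (hB : B.Nondegenerate) {Λ : Submodule ℤ V}
    (hΛ : Λ.FG) (hsp : Submodule.span ℚ (Λ : Set V) = ⊤) : (B.dualSubmodule Λ).FG := by
  haveI : Module.Finite ℤ Λ := Module.Finite.iff_fg.mpr hΛ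
  haveI : IsAddTorsionFree V := IsAddTorsionFree.of_isTorsionFree ℚ V
  haveI : IsAddTorsionFree Λ := Function.Injective.isAddTorsionFree Λ.subtype.toAddMonoidHom Subtype.val_injective
  haveI : Module.Free ℤ Λ := Module.free_of_finite_type_torsion_free'
  exact Module.Finite.iff_fg.mp (Module.Finite.of_injective _ (B.dualSubmoduleToDual_injective hB Λ hsp))

omit [FiniteDimensional ℚ V] in
/-- Membership in the dual lattice: `x ∈ Λ^# ↔ ∀ y ∈ Λ, B(x, y) ∈ ℤ`. [cite: BourbakiAlgebraI1989, Ch. II §5 no. 4] -/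
theorem _root_.Literature.AlgebraicGeometry.Motives.mem_dualSubmodule_iff_exists_intCast (B : LinearMap.BilinForm ℚ V) (Λ : Submodule ℤ V) (x : V) :
    x ∈ B.dualSubmodule Λ ↔ ∀ y ∈ Λ, ∃ m : ℤ, (m : ℚ) = B x y := by
  simp only [LinearMap.BilinForm.mem_dualSubmodule, Submodule.mem_one, eq_intCast]

end HodgeTheory.PolarizedLimitMixedHodgeStructure

/-! ## §2 The dual variation on a fibre: `θ_s⁻¹ : V_s^∨ ⥲ V_s`, filtrations, Hodge norms, forms, integral functionals -/

namespace Motives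

/-- A `ℤ`-linear map into `ℚ` with integral values, as an integral functional (for ANY `ℤ`-module structure on `M` — the fibres of an integral
local system carry the `ModuleCat ℤ` instance). [cite: BourbakiAlgebraI1989, Ch. II §5 no. 4] -/
def liftIntDual {M : Type*} [AddCommGroup M] [Module ℤ M] (g : M →ₗ[ℤ] ℚ) (hg : ∀ u, ∃ m : ℤ, (m : ℚ) = g u) :
    Module.Dual ℤ M where
  toFun u := (hg u).choose
  map_add' u v := by
    apply Int.cast_injective (α := ℚ)
    rw [Int.cast_add, (hg _).choose_spec, (hg u).choose_spec, (hg v).choose_spec, map_add]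
  map_smul' m u := by
    apply Int.cast_injective (α := ℚ)
    rw [smul_eq_mul, RingHom.id_apply, Int.cast_mul, (hg _).choose_spec, (hg u).choose_spec, LinearMap.map_smul, zsmul_eq_mul]

/-- `liftIntDual g hg u = g u` in `ℚ` (any `ℤ`-module structure on `M`, e.g. the one of a `ModuleCat ℤ` fibre). [cite: BourbakiAlgebraI1989, Ch. II §5 no. 4] -/
theorem liftIntDual_apply {M : Type*} [AddCommGroup M] [Module ℤ M] (g : M →ₗ[ℤ] ℚ) (hg : ∀ u, ∃ m : ℤ, (m : ℚ) = g u) (u : M) :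
    ((liftIntDual g hg u : ℤ) : ℚ) = g u :=
  (hg u).choose_spec

namespace VHSData

variable {S : Type} [TopologicalSpace S] {k : ℤ} (D : VHSData S k)

/-- **`V_s` is spanned over `ℚ` by the integral vectors** `toRat(V_ℤ,s)` (`V_s = V_ℤ,s ⊗ ℚ`, the tree's `isBaseChange_toRatLinear`).
[cite: Schmid1973, §2] [cite: Deligne1970, I.1] -/
theorem span_range_toRat_eq_top (s : S) : Submodule.span ℚ (Set.range (D.toRat s)) = ⊤ := by
  refine Submodule.eq_top_iff'.mpr fun x => ?_
  refine (D.isBaseChange_toRatLinear ⟨s⟩).inductionOn x _ (Submodule.zero_mem _) (fun m => Submodule.subset_span ⟨m, rfl⟩)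
    (fun c y hy => Submodule.smul_mem _ c hy) fun y₁ y₂ h₁ h₂ => Submodule.add_mem _ h₁ h₂

section Fibre

variable (s : S)

/-- **`θ_s⁻¹ : V_s^∨ ⥲ V_s`**, the inverse of the polarization isomorphism `θ_s = Q_s♭`, `v ↦ Q_s(v, ·)`, of the fibre at `s`.
[cite: Deligne1982HodgeCycles, I Prop. 3.6 (proof)] [cite: Moonen2017FamiliesMotives, §2.1 (p. 3)] -/
def ofDualFiber : Module.Dual ℚ (D.V.fiber s) ≃ₗ[ℚ] D.V.fiber s :=
  haveI : Module.Finite ℚ (D.V.fiber s) := D.finite_fiber s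
  (D.form s).toDualEquiv.symm

/-- `Q_s(θ_s⁻¹ φ, w) = φ(w)`. [cite: Deligne1982HodgeCycles, I Prop. 3.6 (proof)] -/
theorem form_ofDualFiber_apply (φ : Module.Dual ℚ (D.V.fiber s)) (w : D.V.fiber s) : (D.form s).form (D.ofDualFiber s φ) w = φ w :=
  haveI : Module.Finite ℚ (D.V.fiber s) := D.finite_fiber s
  (D.form s).form_toDualEquiv_symm φ w

/-- The form of `D^∨` at `s` read through `θ_s⁻¹`: `Q_s^∨(φ, ψ) = Q_s(θ_s⁻¹ φ, θ_s⁻¹ ψ)`. [cite: Moonen2017FamiliesMotives, §2.1 (p. 3)] -/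
theorem dual_form_eq (φ ψ : Module.Dual ℚ (D.V.fiber s)) :
    (D.dual.form s).form φ ψ = (D.form s).form (D.ofDualFiber s φ) (D.ofDualFiber s ψ) :=
  rfl

/-- **`θ_s⁻¹` carries `F^q(V_s^∨)` onto `F^{q+k}(V_s)`.** [cite: Deligne1982HodgeCycles, I Prop. 3.6 (proof)] [cite: DeligneHodgeII1971, 1.1.6–1.1.7 and 2.1.15] -/
theorem map_dual_hodge_F (q : ℤ) :
    ((D.dual.hodge s).F q).map ((D.ofDualFiber s : Module.Dual ℚ (D.V.fiber s) →ₗ[ℚ] D.V.fiber s).baseChange ℂ) = (D.hodge s).F (q + k) := by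
  haveI : HodgeTensorFacts.{0, 0} := hodgeTensorFacts_holds
  haveI : Module.Finite ℚ (D.V.fiber s) := D.finite_fiber s
  exact (D.form s).map_dual_F_toDualEquiv_symm q

/-- **`‖ξ‖_{D^∨,s} = ‖θ_s⁻¹ ξ‖_{D,s}`**: the Hodge metric of the dual fibre is that of the fibre through `θ_s⁻¹`. [cite: CarlsonMullerStachPeters2017, §2.3 Thm. 2.3.3] -/
theorem dual_hodgeNorm_eq (x : ℂ ⊗[ℚ] Module.Dual ℚ (D.V.fiber s)) :
    (D.dual.form s).hodgeNorm x = (D.form s).hodgeNorm ((D.ofDualFiber s : Module.Dual ℚ (D.V.fiber s) →ₗ[ℚ] D.V.fiber s).baseChange ℂ x) := by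
  haveI : HodgeTensorFacts.{0, 0} := hodgeTensorFacts_holds
  haveI : Module.Finite ℚ (D.V.fiber s) := D.finite_fiber s
  exact (D.form s).hodgeNorm_dual x

/-- `Q_s(θ_s⁻¹(toRat^∨ φ), toRat u) = φ(u)` for an integral functional `φ ∈ V_ℤ,s^∨`. [cite: BourbakiAlgebraI1989, Ch. II §5 no. 4] [cite: Schmid1973, §2] -/
theorem form_ofDualFiber_dual_toRat (φ : Module.Dual ℤ (D.VZ.fiber s)) (u : D.VZ.fiber s) :
    (D.form s).form (D.ofDualFiber s (show Module.Dual ℚ (D.V.fiber s) from D.dual.toRat s (φ : D.dual.VZ.fiber s))) (D.toRat s u) =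
      ((φ u : ℤ) : ℚ) := by
  rw [form_ofDualFiber_apply]
  exact D.dual_toRat_apply s φ u

variable {V : Type u} [AddCommGroup V] [Module ℚ V]

/-- **The trivialization of the dual fibre through `θ_s⁻¹`**: `e^∨ = e ∘ θ_s⁻¹ : V_s^∨ ⥲ V` for a trivialization `e : V_s ⥲ V`.
[cite: CattaniDeligneKaplan1995, (2.4) (p. 488)] [cite: Deligne1982HodgeCycles, I Prop. 3.6 (proof)] -/
def dualTriv (e : D.V.fiber s ≃ₗ[ℚ] V) : Module.Dual ℚ (D.V.fiber s) ≃ₗ[ℚ] V :=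
  (D.ofDualFiber s).trans e

variable (e : D.V.fiber s ≃ₗ[ℚ] V)

/-- `e^∨ φ = e (θ_s⁻¹ φ)`. [cite: CattaniDeligneKaplan1995, (2.4) (p. 488)] -/
theorem dualTriv_apply (φ : Module.Dual ℚ (D.V.fiber s)) : D.dualTriv s e φ = e (D.ofDualFiber s φ) := rfl

/-- `(e^∨)_ℂ = e_ℂ ∘ (θ_s⁻¹)_ℂ`. [cite: CattaniDeligneKaplan1995, (2.4) (p. 488)] -/
theorem dualTriv_baseChange (x : ℂ ⊗[ℚ] Module.Dual ℚ (D.V.fiber s)) :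
    (D.dualTriv s e).toLinearMap.baseChange ℂ x =
      e.toLinearMap.baseChange ℂ (((D.ofDualFiber s : Module.Dual ℚ (D.V.fiber s) →ₗ[ℚ] D.V.fiber s)).baseChange ℂ x) := by
  rw [← LinearMap.comp_apply, ← LinearMap.baseChange_comp]
  rfl

/-- **`(e^∨)_ℂ F^q(V_s^∨) = e_ℂ F^{q+k}(V_s)`.** [cite: Deligne1982HodgeCycles, I Prop. 3.6 (proof)] [cite: CattaniDeligneKaplan1995, 2.7 (2.7.1) (p. 489)] -/
theorem map_dual_hodge_F_dualTriv (q : ℤ) :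
    ((D.dual.hodge s).F q).map ((D.dualTriv s e).toLinearMap.baseChange ℂ) = ((D.hodge s).F (q + k)).map (e.toLinearMap.baseChange ℂ) := by
  rw [show (D.dualTriv s e).toLinearMap = e.toLinearMap ∘ₗ (D.ofDualFiber s : Module.Dual ℚ (D.V.fiber s) →ₗ[ℚ] D.V.fiber s) from rfl,
    LinearMap.baseChange_comp, Submodule.map_comp, map_dual_hodge_F]

/-- The form of `D^∨` in the chart: `Q_s^∨(φ, ψ) = B(e^∨ φ, e^∨ ψ)` when `e` carries `Q_s` to `B`. [cite: Moonen2017FamiliesMotives, §2.1 (p. 3)] -/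
theorem dual_form_eq_chart {B : LinearMap.BilinForm ℚ V} (hB : ∀ x y : D.V.fiber s, (D.form s).form x y = B (e x) (e y))
    (φ ψ : Module.Dual ℚ (D.V.fiber s)) : (D.dual.form s).form φ ψ = B (D.dualTriv s e φ) (D.dualTriv s e ψ) := by
  rw [dual_form_eq, hB]
  rfl

/-- **`e^∨(V_ℤ,s^∨) ⊆ Λ^#`**: an integral functional goes to the `B`-dual lattice of `Λ ⊆ e(V_ℤ,s)`. [cite: CattaniDeligneKaplan1995, (2.4) (p. 488)]
[cite: BourbakiAlgebraI1989, Ch. II §5 no. 4] -/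
theorem dualTriv_toRat_mem {B : LinearMap.BilinForm ℚ V} (hB : ∀ x y : D.V.fiber s, (D.form s).form x y = B (e x) (e y)) {Λ : Submodule ℤ V}
    (hΛ : ∀ v ∈ Λ, ∃ u : D.VZ.fiber s, e (D.toRat s u) = v) (φ : Module.Dual ℤ (D.VZ.fiber s)) :
    D.dualTriv s e (show Module.Dual ℚ (D.V.fiber s) from D.dual.toRat s (φ : D.dual.VZ.fiber s)) ∈ B.dualSubmodule Λ := by
  rw [mem_dualSubmodule_iff_exists_intCast]
  intro y hy
  obtain ⟨u, rfl⟩ := hΛ y hy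
  exact ⟨φ u, by rw [dualTriv_apply, ← hB, form_ofDualFiber_dual_toRat]⟩

/-- **`Λ^# ⊆ e^∨(V_ℤ,s^∨)`**: every `x` with `B(x, Λ) ⊆ ℤ` is `e^∨` of the integral functional `u ↦ B(x, e(toRat u))`, when `e(V_ℤ,s) ⊆ Λ` and `B` is
nondegenerate. [cite: CattaniDeligneKaplan1995, (2.4) (p. 488)] [cite: BourbakiAlgebraI1989, Ch. II §5 no. 4] -/
theorem exists_dualTriv_toRat_eq {B : LinearMap.BilinForm ℚ V} (hBn : B.Nondegenerate)
    (hB : ∀ x y : D.V.fiber s, (D.form s).form x y = B (e x) (e y)) {Λ : Submodule ℤ V} (he : ∀ u : D.VZ.fiber s, e (D.toRat s u) ∈ Λ) {x : V}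
    (hx : x ∈ B.dualSubmodule Λ) :
    ∃ φ : Module.Dual ℤ (D.VZ.fiber s), D.dualTriv s e (show Module.Dual ℚ (D.V.fiber s) from D.dual.toRat s (φ : D.dual.VZ.fiber s)) = x := by
  rw [mem_dualSubmodule_iff_exists_intCast] at hx
  let g : D.VZ.fiber s →ₗ[ℤ] ℚ := ((B x).restrictScalars ℤ ∘ₗ e.toLinearMap.restrictScalars ℤ) ∘ₗ D.toRatLinear ⟨s⟩
  have hg : ∀ u, ∃ m : ℤ, (m : ℚ) = g u := fun u => hx _ (he u)
  refine ⟨liftIntDual g hg, ?_⟩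
  set ξ : Module.Dual ℚ (D.V.fiber s) := D.dual.toRat s (liftIntDual g hg : D.dual.VZ.fiber s) with hξ
  -- `ξ = B(x, e ·)` on `V_s`: both are `ℚ`-linear and agree on the spanning set `toRat(V_ℤ,s)`
  have hξ' : ξ = (B x) ∘ₗ e.toLinearMap := by
    refine LinearMap.ext_on_range (D.span_range_toRat_eq_top s) fun u => ?_
    rw [LinearMap.comp_apply, LinearEquiv.coe_coe, ← form_ofDualFiber_apply, hξ, form_ofDualFiber_dual_toRat, liftIntDual_apply]
    rfl
  -- nondegeneracy: `B(e θ⁻¹ ξ, ·) = B(x, ·)`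
  apply LinearMap.ker_eq_bot.mp hBn.ker_eq_bot
  refine LinearMap.ext fun w => ?_
  obtain ⟨v, rfl⟩ := e.surjective w
  rw [dualTriv_apply, ← hB, form_ofDualFiber_apply, hξ', LinearMap.comp_apply, LinearEquiv.coe_coe]

end Fibre

/-! ## §3 The puncture chart of the dual variation `D^∨` -/

section Charts

variable {D}
variable {V : Type u} [AddCommGroup V] [Module ℚ V]

namespace PunctureChart

variable [FiniteDimensional ℚ V] {σ : ℂ → S} {L : PolarizedLimitMixedHodgeStructure V k} (C : D.PunctureChart σ L)

/-- **The lattice of a puncture chart spans the reference space**: `ℚ·Λ = V` (`Λ = e_z(V_ℤ,σ(z))` and `V_ℤ ⊗ ℚ = V`).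
[cite: CattaniDeligneKaplan1995, (2.4) (p. 488)] [cite: Schmid1973, §2] -/
theorem span_Λ_eq_top : Submodule.span ℚ (C.Λ : Set V) = ⊤ := by
  set z : ℂ := ⟨0, C.A₀⟩
  have hz : C.A₀ ≤ z.im := le_rfl
  refine Submodule.eq_top_iff'.mpr fun x => ?_
  obtain ⟨v, rfl⟩ := (C.e z).surjective x
  have hv : v ∈ (⊤ : Submodule ℚ (D.V.fiber (σ z))) := Submodule.mem_top
  rw [← D.span_range_toRat_eq_top (σ z)] at hv
  have hle : (Submodule.span ℚ (Set.range (D.toRat (σ z)))).map (C.e z).toLinearMap ≤ Submodule.span ℚ (C.Λ : Set V) := by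
    rw [Submodule.map_span_le]
    rintro _ ⟨u, rfl⟩
    exact Submodule.subset_span (C.e_toRat_mem z hz u)
  exact hle ⟨v, hv, rfl⟩

/-- **THE PUNCTURE CHART OF THE DUAL VARIATION.**  From a chart of `D` at a puncture with limit `L = (W, F, N, Q)` on `V` — gauge `Γ`, lattice `Λ`,
trivializations `e_z`, height `A₀` — the chart of `D^∨` with limit **`L(k)` re-indexed to weight `−k`** (which IS the dual `L^∨` through the
polarization isomorphism `Q♭ : L(k) ⥲ L^∨`, the tree's `comapEquiv_qFlatEquiv_symm`): the SAME gauge `Γ` and nilpotent orbit, the trivializations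
`e_z^∨ = e_z ∘ θ_{σ(z)}⁻¹` (`θ_s = Q_s♭`, so that `e_z^∨(F^q(V^∨)) = e_z(F^{q+k}) = exp(zN)exp(Γ(s))F^{q+k}(L) = exp(zN)exp(Γ(s))F^q(L(k))` and `Q^∨ ↦ Q`),
and the **`Q`-DUAL LATTICE `Λ^# = {x ∈ V | Q(x, Λ) ⊆ ℤ} = e_z^∨(V_ℤ^∨)`** (finitely generated since `Λ` spans `V`; `T`-stable since `T` is a
`Q`-isometry mapping `Λ` onto `Λ`).  [cite: CattaniDeligneKaplan1995, (2.4) (p. 488), 2.7 (2.7.1) (p. 489)] [cite: Deligne1982HodgeCycles, I Prop. 3.6 (proof)]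
[cite: Schmid1973, §2 (variations are stable under duals; cite only)] [cite: Deligne1980, (1.6.9) (ii)] -/
def dual : D.dual.PunctureChart σ ((L.tateTwist k).cast (tateTwist_self_weight k)) where
  Γ := C.Γ
  Γ_zero := C.Γ_zero
  analyticAt_Γ := C.analyticAt_Γ
  Γ_mem s := by
    rw [L.tateTwist_cast_endPiece_biSup]
    exact C.Γ_mem s
  Λ := L.Q.dualSubmodule C.Λ
  fg_Λ := fg_dualSubmodule L.Q L.nondegenerate_Q C.fg_Λ C.span_Λ_eq_top
  monodromy_mem x hx := by
    rw [L.tateTwist_cast_monodromy]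
    exact L.monodromy_mem_dualSubmodule C.monodromy_mem hx
  e z := D.dualTriv (σ z) (C.e z)
  A₀ := C.A₀
  map_F_eq z hz q := by
    rw [L.tateTwist_cast_F, L.tateTwist_cast_N]
    exact (D.map_dual_hodge_F_dualTriv (σ z) (C.e z) q).trans (C.map_F_eq z hz (q + k))
  form_eq z hz φ ψ := by
    rw [L.tateTwist_cast_Q]
    exact D.dual_form_eq_chart (σ z) (C.e z) (C.form_eq z hz) φ ψ
  e_toRat_mem z hz φ := D.dualTriv_toRat_mem (σ z) (C.e z) (C.form_eq z hz) (C.exists_e_toRat_eq z hz) φ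
  exists_e_toRat_eq z hz x hx := D.exists_dualTriv_toRat_eq (σ z) (C.e z) L.nondegenerate_Q (C.form_eq z hz) (C.e_toRat_mem z hz) hx

/-- The dual chart keeps the gauge. [cite: CattaniDeligneKaplan1995, 2.7 (p. 489)] -/
theorem dual_Γ : C.dual.Γ = C.Γ := rfl

/-- The lattice of the dual chart is the `Q`-dual lattice `Λ^#`. [cite: CattaniDeligneKaplan1995, (2.4) (p. 488)] -/
theorem dual_Λ : C.dual.Λ = L.Q.dualSubmodule C.Λ := rfl

/-- The trivializations of the dual chart are `e_z ∘ θ⁻¹`. [cite: CattaniDeligneKaplan1995, (2.4) (p. 488)] -/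
theorem dual_e (z : ℂ) : C.dual.e z = D.dualTriv (σ z) (C.e z) := rfl

/-- The dual chart keeps the height. [cite: CattaniDeligneKaplan1995, (2.4) (p. 488)] -/
theorem dual_A₀ : C.dual.A₀ = C.A₀ := rfl

end PunctureChart

/-! ## §4 The interior chart of the dual variation `D^∨` -/

namespace InteriorChart

variable {ψ : OpenPartialHomeomorph S ℂ} {H₀ : HodgeStructure V k} {P₀ : H₀.Polarization} (C : D.InteriorChart ψ P₀)

/-- The lattice of an interior chart spans the reference space as soon as the chart has a point. [cite: CattaniDeligneKaplan1995, §1 (p. 484)] [cite: Schmid1973, §2] -/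
theorem span_Λ_eq_top {c : ℂ} (hc : c ∈ ψ.target) : Submodule.span ℚ (C.Λ : Set V) = ⊤ := by
  refine Submodule.eq_top_iff'.mpr fun x => ?_
  obtain ⟨v, rfl⟩ := (C.e c).surjective x
  have hv : v ∈ (⊤ : Submodule ℚ (D.V.fiber (ψ.symm c))) := Submodule.mem_top
  rw [← D.span_range_toRat_eq_top (ψ.symm c)] at hv
  have hle : (Submodule.span ℚ (Set.range (D.toRat (ψ.symm c)))).map (C.e c).toLinearMap ≤ Submodule.span ℚ (C.Λ : Set V) := by
    rw [Submodule.map_span_le]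
    rintro _ ⟨u, rfl⟩
    exact Submodule.subset_span (C.e_toRat_mem c hc u)
  exact hle ⟨v, hv, rfl⟩

/-- **THE INTERIOR CHART OF THE DUAL VARIATION.**  From an interior chart of `D` on the coordinate disc `ψ` with reference `(H₀, Q₀)`, frame `h`,
lattice `Λ`, constant `κ`: the interior chart of `D^∨` with reference **`(H₀(k), Q₀)` re-indexed to weight `−k`** (`≅ (H₀^∨, Q₀^∨)` by `Q₀♭`),
trivializations `e_c^∨ = e_c ∘ θ⁻¹` (`e_c^∨ F^q(V^∨) = e_c F^{q+k} = h(c)⁻¹F₀^{q+k}`), the SAME frame `h` and constant `κ` (`θ⁻¹` is an isometry of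
Hodge metrics, `hodgeNorm_dual`), and the `Q₀`-dual lattice `Λ^#` (defined as `⊥` in the degenerate case of an empty disc, where nothing is claimed).
[cite: CattaniDeligneKaplan1995, §1 (pp. 483–484)] [cite: Deligne1982HodgeCycles, I Prop. 3.6 (proof)] [cite: Schmid1973, §2 (cite only)] -/
def dual : D.dual.InteriorChart ψ ((P₀.tateTwist k).cast (tateTwist_self_weight k)) where
  isPreconnected_target := C.isPreconnected_target
  e c := D.dualTriv (ψ.symm c) (C.e c)
  h := C.h
  analyticOnNhd_h := C.analyticOnNhd_h
  isUnit_h := C.isUnit_h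
  map_F_eq c hc q := by
    rw [H₀.tateTwist_cast_F]
    exact (D.map_dual_hodge_F_dualTriv (ψ.symm c) (C.e c) q).trans (C.map_F_eq c hc (q + k))
  form_eq c hc φ χ := by
    rw [P₀.tateTwist_cast_form]
    exact D.dual_form_eq_chart (ψ.symm c) (C.e c) (C.form_eq c hc) φ χ
  Λ := ⨆ _ : (ψ.target).Nonempty, P₀.form.dualSubmodule C.Λ
  fg_Λ := by
    by_cases hne : (ψ.target).Nonempty
    · rw [iSup_pos hne]
      obtain ⟨c, hc⟩ := hne
      exact fg_dualSubmodule P₀.form P₀.nondegenerate C.fg_Λ (C.span_Λ_eq_top hc)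
    · rw [iSup_neg hne]
      exact Submodule.fg_bot
  e_toRat_mem c hc φ := by
    rw [iSup_pos ⟨c, hc⟩]
    exact D.dualTriv_toRat_mem (ψ.symm c) (C.e c) (C.form_eq c hc) (C.exists_e_toRat_eq c hc) φ
  exists_e_toRat_eq c hc x hx := by
    rw [iSup_pos ⟨c, hc⟩] at hx
    exact D.exists_dualTriv_toRat_eq (ψ.symm c) (C.e c) P₀.nondegenerate (C.form_eq c hc) (C.e_toRat_mem c hc) hx
  κ := C.κ
  κ_pos := C.κ_pos
  mul_hodgeNorm_le c hc x := by
    -- honest types first (the fibre types are `ModuleCat` carriers): `κ‖e_c,ℂ(θ⁻¹_ℂ x)‖₀ ≤ ‖θ⁻¹_ℂ x‖ = ‖x‖_{D^∨}`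
    have h := C.mul_hodgeNorm_le c hc
      (((D.ofDualFiber (ψ.symm c) : Module.Dual ℚ (D.V.fiber (ψ.symm c)) →ₗ[ℚ] D.V.fiber (ψ.symm c))).baseChange ℂ x)
    rw [← D.dualTriv_baseChange, ← D.dual_hodgeNorm_eq, ← P₀.hodgeNorm_tateTwist_cast k (tateTwist_self_weight k)] at h
    exact h

/-- The dual interior chart keeps the frame. [cite: CattaniDeligneKaplan1995, §1 (p. 484)] -/
theorem dual_h : C.dual.h = C.h := rfl

/-- The dual interior chart keeps the comparison constant. [cite: CattaniDeligneKaplan1995, §1 (p. 484)] -/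
theorem dual_κ : C.dual.κ = C.κ := rfl

/-- The trivializations of the dual interior chart are `e_c ∘ θ⁻¹`. [cite: CattaniDeligneKaplan1995, §1 (p. 484)] -/
theorem dual_e (c : ℂ) : C.dual.e c = D.dualTriv (ψ.symm c) (C.e c) := rfl

/-- On a disc with a point, the lattice of the dual interior chart is the `Q₀`-dual lattice `Λ^#`. [cite: CattaniDeligneKaplan1995, §1 (p. 484)] -/
theorem dual_Λ (hne : (ψ.target).Nonempty) : C.dual.Λ = P₀.form.dualSubmodule C.Λ :=
  iSup_pos hne

end InteriorChart

end Charts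

/-! ## §5 Theorem 1.1 (`r = 1`) for the dual variation from the charts of `D` -/

section Global

variable {V : Type u} [AddCommGroup V] [Module ℚ V] [FiniteDimensional ℚ V]

/-- **CDK THEOREM 1.1 / COROLLARY 1.2 (`r = 1`) FOR THE DUAL VARIATION `D^∨` OVER A CURVE, FROM THE CHARTS OF `D`.**  `S` preconnected; interior
charts of `D` around every point, puncture charts of `D` along the ends `σ i`, open ends and a compact core beyond the heights.  Then for
`p + p = −k`: **the set of `s ∈ S` carrying a nonzero integral functional `φ ∈ V_ℤ,s^∨` of type `(p, p)` with `Q_s^∨(φ, φ) ≤ K` is ALL of `S` or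
FINITE** (the charts of `D^∨` are `InteriorChart.dual`, `PunctureChart.dual`). [cite: CattaniDeligneKaplan1995, Thm. 1.1, Cor. 1.2 (p. 484), Thm. 1.5 and «Proof of 1.5 ⟹ 1.1» (p. 485)] -/
theorem hodgeLocusOfNormLe_dual_eq_univ_or_finite [PreconnectedSpace S] {p : ℤ} (hpk : p + p = -k) (K : ℤ)
    (hint : ∀ x : S, ∃ (ψ : OpenPartialHomeomorph S ℂ) (H₀ : HodgeStructure V k) (P₀ : H₀.Polarization),
      x ∈ ψ.source ∧ Nonempty (D.InteriorChart ψ P₀))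
    {ι : Type*} {σ : ι → ℂ → S} {L : ι → PolarizedLimitMixedHodgeStructure V k} (C : ∀ i, D.PunctureChart (σ i) (L i))
    (hopen : ∀ (i : ι) (A : ℝ), (C i).A₀ ≤ A → IsOpen (σ i '' {z : ℂ | A < z.im}))
    (hcore : ∀ A : ι → ℝ, (∀ i, (C i).A₀ ≤ A i) → ∃ K₀ : Set S, IsCompact K₀ ∧ K₀ ∪ ⋃ i, σ i '' {z : ℂ | A i < z.im} = univ) :
    D.dual.hodgeLocusOfNormLe p K = univ ∨ (D.dual.hodgeLocusOfNormLe p K).Finite := by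
  refine D.dual.hodgeLocusOfNormLe_eq_univ_or_finite_of_charts hpk K (fun x => ?_) (fun i => (C i).dual) hopen hcore
  obtain ⟨ψ, H₀, P₀, hx, ⟨Cx⟩⟩ := hint x
  exact ⟨ψ, _, (P₀.tateTwist k).cast (tateTwist_self_weight k), hx, ⟨Cx.dual⟩⟩

variable {X : Type*} [TopologicalSpace X] [CompactSpace X]

/-- **THEOREM 1.1 / COROLLARY 1.2 FOR `D^∨` OVER A PUNCTURED COMPACT CURVE** (ends and core from a compactification `j : S ↪ X` with disc charts at the
punctures, as in `hodgeLocusOfNormLe_eq_univ_or_finite_of_charts_of_compactification`). [cite: CattaniDeligneKaplan1995, Thm. 1.1, Cor. 1.2 (p. 484), 2.3 (p. 487)] -/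
theorem hodgeLocusOfNormLe_dual_eq_univ_or_finite_of_compactification [PreconnectedSpace S] {p : ℤ} (hpk : p + p = -k) (K : ℤ)
    (hint : ∀ x : S, ∃ (ψ : OpenPartialHomeomorph S ℂ) (H₀ : HodgeStructure V k) (P₀ : H₀.Polarization),
      x ∈ ψ.source ∧ Nonempty (D.InteriorChart ψ P₀))
    {ι : Type*} {σ : ι → ℂ → S} {L : ι → PolarizedLimitMixedHodgeStructure V k} (C : ∀ i, D.PunctureChart (σ i) (L i))
    {j : S → X} (hj : IsEmbedding j) (pt : ι → X) (hpS : ∀ i, pt i ∉ range j) (hcov : ∀ x : X, x ∉ range j → ∃ i, x = pt i)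
    (φ : ι → OpenPartialHomeomorph X ℂ) (hp : ∀ i, pt i ∈ (φ i).source) (hφp : ∀ i, φ i (pt i) = 0)
    (hball : ∀ i, Metric.ball (0 : ℂ) (Real.exp (-(2 * Real.pi * (C i).A₀))) ⊆ (φ i).target)
    (hσ : ∀ (i : ι) (z : ℂ), (C i).A₀ < z.im → j (σ i z) = (φ i).symm (Complex.exp (2 * Real.pi * Complex.I * z))) :
    D.dual.hodgeLocusOfNormLe p K = univ ∨ (D.dual.hodgeLocusOfNormLe p K).Finite := by
  refine D.dual.hodgeLocusOfNormLe_eq_univ_or_finite_of_charts_of_compactification hpk K (fun x => ?_) (fun i => (C i).dual) hj pt hpS hcov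
    φ hp hφp hball hσ
  obtain ⟨ψ, H₀, P₀, hx, ⟨Cx⟩⟩ := hint x
  exact ⟨ψ, _, (P₀.tateTwist k).cast (tateTwist_self_weight k), hx, ⟨Cx.dual⟩⟩

end Global

end VHSData

end Motives

end Literature.AlgebraicGeometry

end
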